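import Literature.Geometry.Kaehler.ChartWindowSheets
import Literature.Geometry.GeometricMeasureTheory.CurrentsNullCarrier
import Literature.Geometry.GeometricMeasureTheory.CurrentsProductBoundary

/-!
# The collapse of the blow-ups over a chart window is a multiple of the graph current

Continuing `ChartWindowBlowUp.lean` / `ChartWindowSheets.lean`. For a chart window `W` with
sheet number `c` (the same for all `0 < r < r₀`):

* `ChartWindow.graphMap` — **the smooth chart projection `g = Ψ ∘ k`** (globally smooth after
  shrinking the argument of `Ψ` into its ball by a cutoff; `g = Ψ ∘ k` on `{‖k‖ ≤ a₁}`,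
  `g ∘ q = g`, and the collapse `h = g` on the core);
* `ChartWindow.pushforward_disc_eq_graphCurrent` — **`g_#(c · [disc]) = c · [Γ]`**: the chart
  projection maps the flat disc current `c · [m + ball_K(0,a₃)]` to `c` times the graph current
  over `ball_K(0, a₃)` (area formula for the isometric parametrisation of the disc);
* `HolomorphicChain.projPiece_eq_disc` — **`Q_r = c · [disc]` exactly** (the part of `Q_r` off the
  open slab is a rectifiable current carried by a `(2p−1)`-sphere, hence `0`,
  `Current.IsLocallyRectifiable.eq_zero_of_support_subset_null`);
* `HolomorphicChain.collapse_pushforward_corePiece` — **`h_#(D_r ⌞ innerCore) = c · [Γ]`**: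
  `h = g` near the support, `g = g ∘ q`, so `h_#(D_r ⌞ innerCore) = g_#(Q_r) = g_#(c·[disc])`.

Definitions with bodies + theorems; no named facts.

## References

* H. Federer, *Geometric Measure Theory*, Springer 1969, 4.1.7, 4.1.30, 4.3.16–4.3.18 [Federer1969].
* J. R. King, *The currents defined by analytic varieties*, Acta Math. 127 (1971), §5.
-/

noncomputable section

open scoped Manifold Topology ENNReal NNReal InnerProductSpace ContDiff Distributions
open Set Filter MeasureTheory Metric Function Module TopologicalSpace Real

namespace Literature.Geometry.GeometricMeasureTheory

/-! ### Push-forwards by maps agreeing near the support -/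

section CongrFun

variable {E E' : Type*} [NormedAddCommGroup E] [NormedSpace ℝ E] [FiniteDimensional ℝ E]
  [NormedAddCommGroup E'] [NormedSpace ℝ E'] {Ω : Opens E} {Ω' : Opens E'} {m : ℕ}

/-- **The push-forward only depends on the map near the support**: if `f = g` on an open
`U ⊇ spt T` then `f_# T = g_# T`. [cite: Federer1969, 4.1.7] -/
theorem Current.pushforward_congr_fun_of_eqOn (T : Current Ω m) (χ : 𝓓(Ω, ℝ)) {f g : E → E'}
    (hf : ContDiff ℝ ∞ f) (hg : ContDiff ℝ ∞ g) {U : Set E} (hU : IsOpen U) (hTU : T.support ⊆ U)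
    (h : ∀ x ∈ U, f x = g x) : T.pushforward Ω' χ hf = T.pushforward Ω' χ hg := by
  ext φ
  rw [Current.pushforward_apply, Current.pushforward_apply, ← sub_eq_zero, ← map_sub]
  refine T.apply_eq_zero_of_eqOn hU hTU fun x hx => ?_
  show TestForm.pullback χ hf φ x - TestForm.pullback χ hg φ x = 0
  have hfg : f =ᶠ[𝓝 x] g := eventually_of_mem (hU.mem_nhds hx) h
  rw [TestForm.pullback_apply, TestForm.pullback_apply, h x hx, hfg.fderiv_eq, sub_self]

end CongrFun

end Literature.Geometry.GeometricMeasureTheory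

namespace Literature.Geometry.Kaehler

open Literature.Geometry.GeometricMeasureTheory

-- Nested operator-norm instances on (duals of) `V [⋀^Fin n]→L[ℝ] ℝ`.
set_option maxSynthPendingDepth 2

universe u

variable {V : Type u} [NormedAddCommGroup V] [InnerProductSpace ℂ V] [FiniteDimensional ℂ V]

/-! ### The smooth chart projection -/

namespace ChartWindow

variable (W : ChartWindow V)

/-- The intermediate radius `ρ♭ = (a₁ + ρ)/2 ∈ (a₁, ρ)`. [folklore] -/
def ρFlat : ℝ := (W.a₁ + W.ρ) / 2

/-- `a₁ < ρ♭`. [folklore] -/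
theorem a₁_lt_ρFlat : W.a₁ < W.ρFlat := by unfold ρFlat; linarith [W.a₁_lt]

/-- `ρ♭ < ρ`. [folklore] -/
theorem ρFlat_lt_ρ : W.ρFlat < W.ρ := by unfold ρFlat; linarith [W.a₁_lt]

/-- The radial shrinking factor `σ((ρ♭² − ‖k‖²)/(ρ♭² − a₁²))`: `1` on `𝐁(0,a₁)`, `0` off `B(0,ρ♭)`.
[folklore] -/
def shrink (k : W.K) : ℝ := smoothTransition ((W.ρFlat ^ 2 - ‖k‖ ^ 2) / (W.ρFlat ^ 2 - W.a₁ ^ 2))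

/-- `shrink = 1` on `𝐁(0, a₁)`. [folklore] -/
theorem shrink_eq_one {k : W.K} (hk : ‖k‖ ≤ W.a₁) : W.shrink k = 1 := by
  have h1 := W.a₁_lt_ρFlat
  have h0 := W.a₁_pos
  refine smoothTransition.one_of_one_le ?_
  rw [le_div_iff₀ (by nlinarith), one_mul]
  nlinarith [norm_nonneg k]

/-- `shrink = 0` off `B(0, ρ♭)`. [folklore] -/
theorem shrink_eq_zero {k : W.K} (hk : W.ρFlat ≤ ‖k‖) : W.shrink k = 0 := by
  have h1 := W.a₁_lt_ρFlat
  have h0 := W.a₁_pos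
  refine smoothTransition.zero_of_nonpos (div_nonpos_of_nonpos_of_nonneg ?_ ?_)
  · nlinarith [norm_nonneg k]
  · nlinarith

/-- The shrunk argument `shrink(k) • k` always lies in the chart ball. [folklore] -/
theorem shrink_smul_mem_ball (k : W.K) : (W.shrink k : ℂ) • k ∈ ball (0 : W.K) W.ρ := by
  rw [mem_ball_zero_iff, norm_smul, Complex.norm_real, Real.norm_eq_abs,
    abs_of_nonneg (show 0 ≤ W.shrink k from smoothTransition.nonneg _)]
  by_cases hk : ‖k‖ < W.ρFlat
  · calc W.shrink k * ‖k‖ ≤ 1 * ‖k‖ :=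
          mul_le_mul_of_nonneg_right (smoothTransition.le_one _) (norm_nonneg _)
      _ < W.ρ := by rw [one_mul]; exact hk.trans W.ρFlat_lt_ρ
  · rw [W.shrink_eq_zero (not_lt.1 hk), zero_mul]; exact W.ρ_pos

/-- **The globally smooth extension `Ψ♭(k) = Ψ(shrink(k) k)` of the chart** (`= Ψ` on `𝐁(0,a₁)`).
[folklore] -/
def chartExt (k : W.K) : V := W.Ψ ((W.shrink k : ℂ) • k)

/-- `Ψ♭ = Ψ` on `𝐁(0, a₁)`. [folklore] -/
theorem chartExt_eq {k : W.K} (hk : ‖k‖ ≤ W.a₁) : W.chartExt k = W.Ψ k := by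
  rw [chartExt, W.shrink_eq_one hk]; simp

/-- `Ψ♭` is smooth. [folklore] -/
theorem contDiff_chartExt : ContDiff ℝ ∞ W.chartExt := by
  have han := Literature.Analysis.Complex.SCV.analyticOnNhd_of_differentiableOn W.differentiableOn
    isOpen_ball
  have hΨ : ContDiffOn ℝ ∞ W.Ψ (ball 0 W.ρ) :=
    (han.contDiffOn (n := ∞) isOpen_ball.uniqueDiffOn).restrict_scalars ℝ
  have hs : ContDiff ℝ ∞ W.shrink :=
    smoothTransition.contDiff.comp ((contDiff_const.sub (contDiff_norm_sq ℂ)).div_const _)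
  have hinner : ContDiff ℝ ∞ fun k : W.K => (W.shrink k : ℂ) • k :=
    (Complex.ofRealCLM.contDiff.comp hs).smul contDiff_id
  exact hΨ.comp_contDiff hinner W.shrink_smul_mem_ball

/-- **The smooth chart projection `g = Ψ♭ ∘ k`.** [cite: Federer1969, 4.3.18] -/
def graphMap (x : V) : V := W.chartExt (W.kf x)

/-- `g` is smooth. [folklore] -/
theorem contDiff_graphMap : ContDiff ℝ ∞ W.graphMap := W.contDiff_chartExt.comp W.contDiff_kf

/-- `g = Ψ ∘ k` on `{‖k‖ ≤ a₁}`. [folklore] -/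
theorem graphMap_eq {x : V} (hx : ‖W.kf x‖ ≤ W.a₁) : W.graphMap x = W.Ψ (W.kf x) :=
  W.chartExt_eq hx

/-- `g ∘ q = g`. [folklore] -/
theorem graphMap_proj (x : V) : W.graphMap (W.proj x) = W.graphMap x := by
  simp only [graphMap, W.kf_proj]

/-- **The collapse equals `g` on the open set `{‖k‖ < a₂, ‖w‖ < τ/2}`.** [folklore] -/
theorem collapse_eq_graphMap {x : V} (hk : ‖W.kf x‖ < W.a₂) (hw : ‖W.wf x‖ < W.τ / 2) :
    W.collapse x = W.graphMap x := by
  rw [W.collapse_eq_chart hk.le hw.le, W.graphMap_eq (hk.le.trans W.a₂_lt.le)]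

/-- The open set `{‖k‖ < a₂, ‖w‖ < τ/2}`. [folklore] -/
def coreOpen : Set V := {x | ‖W.kf x‖ < W.a₂ ∧ ‖W.wf x‖ < W.τ / 2}

/-- `coreOpen` is open. [folklore] -/
theorem isOpen_coreOpen : IsOpen W.coreOpen := by
  have h1 : IsOpen {x : V | ‖W.kf x‖ < W.a₂} :=
    isOpen_lt (continuous_norm.comp W.contDiff_kf.continuous) continuous_const
  have h2 : IsOpen ({x : V | ‖W.kf x‖ < W.ρ} ∩ W.wf ⁻¹' ball 0 (W.τ / 2)) :=
    W.contDiffOn_wf.continuousOn.isOpen_inter_preimage W.isOpen_chartDomain isOpen_ball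
  have hρ : W.a₂ < W.ρ := W.a₂_lt.trans W.a₁_lt
  have : W.coreOpen = {x : V | ‖W.kf x‖ < W.a₂} ∩ ({x : V | ‖W.kf x‖ < W.ρ} ∩ W.wf ⁻¹' ball 0 (W.τ / 2)) := by
    ext x
    simp only [coreOpen, mem_setOf_eq, mem_inter_iff, mem_preimage, mem_ball_zero_iff]
    exact ⟨fun ⟨h1, h2⟩ => ⟨h1, h1.trans hρ, h2⟩, fun ⟨h1, _, h2⟩ => ⟨h1, h2⟩⟩
  rw [this]; exact h1.inter h2

/-- `D g = DΨ(k x) ∘ P_K` on `{‖k‖ < a₁}`. [folklore] -/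
theorem hasFDerivAt_graphMap {x : V} (hx : ‖W.kf x‖ < W.a₁) :
    HasFDerivAt W.graphMap ((W.chartDeriv (W.kf x)).comp
      (W.K.orthogonalProjectionOnto.restrictScalars ℝ)) x := by
  have hopen : IsOpen {y : V | ‖W.kf y‖ < W.a₁} :=
    isOpen_lt (continuous_norm.comp W.contDiff_kf.continuous) continuous_const
  have heq : W.graphMap =ᶠ[𝓝 x] fun y => W.Ψ (W.kf y) :=
    eventually_of_mem (hopen.mem_nhds hx) fun y hy => W.graphMap_eq (le_of_lt hy)
  rw [heq.hasFDerivAt_iff]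
  have hk : HasFDerivAt W.kf (W.K.orthogonalProjectionOnto.restrictScalars ℝ) x := by
    have h := ((W.K.orthogonalProjectionOnto.restrictScalars ℝ).hasFDerivAt (x := x - W.m)).comp x
      ((hasFDerivAt_id x).sub_const W.m)
    rw [ContinuousLinearMap.comp_id] at h
    exact h
  have hΨ : HasFDerivAt W.Ψ (W.chartDeriv (W.kf x)) (W.kf x) := by
    have hkρ : W.kf x ∈ ball (0 : W.K) W.ρ := mem_ball_zero_iff.2 (hx.trans W.a₁_lt)
    exact ((W.differentiableOn _ hkρ).differentiableAt (isOpen_ball.mem_nhds hkρ)).hasFDerivAt.restrictScalars ℝ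
  exact hΨ.comp x hk

section Current

variable [MeasurableSpace V] [BorelSpace V] {q : ℕ}

/-- **Integration over the affine disc**: for the isometric parametrisation `ι k = m + k` of the
plane, `∫_{ι(s)} F d𝓗ⁿ = ∫_s F(ι k) dk` (`n = dim_ℝ K`). [folklore] -/
theorem setIntegral_image_plane_eq (hKp : finrank ℂ W.K = q + 1) {s : Set W.K}
    (hs : MeasurableSet s) (F : V → ℝ) :
    letI : InnerProductSpace ℝ V := InnerProductSpace.complexToReal
    letI : InnerProductSpace ℝ W.K := InnerProductSpace.complexToReal
    ∫ x in (fun k : W.K => W.m + (k : V)) '' s, F x ∂(μHE[2 * (q + 1)] : Measure V) =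
      ∫ k in s, F (W.m + (k : V)) := by
  letI : InnerProductSpace ℝ V := InnerProductSpace.complexToReal
  letI : InnerProductSpace ℝ W.K := InnerProductSpace.complexToReal
  haveI : FiniteDimensional ℝ W.K := FiniteDimensional.complexToReal W.K
  set ι : W.K → V := fun k => W.m + (k : V) with hι
  have hiso : Isometry ι := Isometry.of_dist_eq fun x y => by
    rw [dist_eq_norm, dist_eq_norm, hι, add_sub_add_left_eq_sub, ← Submodule.coe_sub, Submodule.coe_norm]
  have hemb : MeasurableEmbedding ι := hiso.isClosedEmbedding.measurableEmbedding
  have hdim : finrank ℝ W.K = 2 * (q + 1) := by rw [finrank_real_of_complex, hKp]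
  have hmap : Measure.map ι (volume : Measure W.K) = (μHE[2 * (q + 1)] : Measure V).restrict (range ι) := by
    rw [← InnerProductSpace.euclideanHausdorffMeasure_eq_volume, hdim]
    exact hiso.map_euclideanHausdorffMeasure
  have hsub : ι '' s ⊆ range ι := image_subset_range _ _
  have h1 : Measure.map ι ((volume : Measure W.K).restrict (ι ⁻¹' (ι '' s))) =
      (μHE[2 * (q + 1)] : Measure V).restrict (ι '' s) := by
    rw [← hemb.restrict_map, hmap, Measure.restrict_restrict (hemb.measurableSet_image.2 hs),
      inter_eq_left.2 hsub]
  rw [preimage_image_eq _ hemb.injective] at h1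
  rw [← h1, hemb.integral_map]

/-- **`g_#(c · [disc]) = c · [Γ]`**: the smooth chart projection maps the flat disc current
`c · [m + ball_K(0,a₃)]` (oriented by `e`) to `c` times the graph current over `ball_K(0, a₃)`,
for any cutoff `= 1` near the closed disc. [cite: Federer1969, 4.1.7, 4.1.30, 3.2.5] -/
theorem pushforward_disc_eq_graphCurrent (hKp : finrank ℂ W.K = q + 1)
    (e : letI : InnerProductSpace ℝ W.K := InnerProductSpace.complexToReal
      OrthonormalBasis (Fin (2 * (q + 1))) ℝ W.K)
    (c : ℤ) {M : ℝ} (hM : ∀ k ∈ ball (0 : W.K) W.ρ, ‖fderiv ℂ W.Ψ k‖ ≤ M) (χ : 𝓓((⊤ : Opens V), ℝ))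
    {U : Set V} (hdU : (fun k : W.K => W.m + (k : V)) '' closedBall (0 : W.K) W.a₃ ⊆ U)
    (hχ : ∀ x ∈ U, χ x = 1) :
    letI : InnerProductSpace ℝ V := InnerProductSpace.complexToReal
    (currentOfIntegration (W.slab ∩ {x | x - W.m ∈ W.K}) (fun _ => c)
        (fun _ => fun i => ((e i : W.K) : V)) : Current (⊤ : Opens V) (2 * (q + 1))).pushforward ⊤ χ
      W.contDiff_graphMap = (c : ℝ) • W.graphCurrent e 1 W.a₃ := by
  letI : InnerProductSpace ℝ V := InnerProductSpace.complexToReal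
  letI : InnerProductSpace ℝ W.K := InnerProductSpace.complexToReal
  haveI : FiniteDimensional ℝ W.K := FiniteDimensional.complexToReal W.K
  have ha₃ρ : W.a₃ ≤ W.ρ := (W.a₃_lt.trans (W.a₂_lt.trans W.a₁_lt)).le
  set D : Set V := W.slab ∩ {x | x - W.m ∈ W.K} with hD
  have hDfin : (μHE[2 * (q + 1)] : Measure V) D < ⊤ := W.measure_slab_inter_plane_lt_top hKp
  have hli : LocallyIntegrableOn (fun _ : V => ((c : ℤ) : ℝ) • frameVector fun i => ((e i : W.K) : V))
      ((⊤ : Opens V) : Set V) ((μHE[2 * (q + 1)] : Measure V).restrict D) := by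
    haveI : IsFiniteMeasure ((μHE[2 * (q + 1)] : Measure V).restrict D) :=
      ⟨by rwa [Measure.restrict_apply_univ]⟩
    exact (integrable_const _).locallyIntegrable.locallyIntegrableOn _
  ext φ
  rw [Current.pushforward_apply, currentOfIntegration_apply hli, _root_.smul_apply,
    W.graphCurrent_apply e 1 ha₃ρ hM, Int.cast_one, one_mul, smul_eq_mul, integral_const_mul,
    hD, W.slab_inter_plane_eq, W.setIntegral_image_plane_eq hKp measurableSet_ball]
  congr 1
  refine setIntegral_congr_fun measurableSet_ball fun k hk => ?_
  -- the pulled-back form at the point `m + k` of the disc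
  have hkf : W.kf (W.m + (k : V)) = k := by
    simp only [ChartWindow.kf, add_sub_cancel_left]
    exact W.K.orthogonalProjectionOnto_mem_subspace_eq_self k
  have hk3 : ‖k‖ < W.a₃ := mem_ball_zero_iff.1 hk
  have hk1 : ‖W.kf (W.m + (k : V))‖ < W.a₁ := by rw [hkf]; exact hk3.trans (W.a₃_lt.trans W.a₂_lt)
  have hone : χ (W.m + (k : V)) = 1 := hχ _ (hdU ⟨k, mem_closedBall_zero_iff.2 hk3.le, rfl⟩)
  have hg : W.graphMap (W.m + (k : V)) = W.Ψ k := by rw [W.graphMap_eq hk1.le, hkf]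
  have hD' : fderiv ℝ W.graphMap (W.m + (k : V)) =
      (W.chartDeriv k).comp (W.K.orthogonalProjectionOnto.restrictScalars ℝ) := by
    have := (W.hasFDerivAt_graphMap hk1).fderiv
    rwa [hkf] at this
  rw [TestForm.pullback_apply, hone, one_smul, hg, hD', ContinuousAlternatingMap.compContinuousLinearMap_apply]
  congr 1
  funext j
  simp only [comp_apply, ContinuousLinearMap.coe_comp, ContinuousLinearMap.coe_restrictScalars']
  rw [W.K.orthogonalProjectionOnto_mem_subspace_eq_self]

end Current

end ChartWindow

/-! ### `Q_r = c · [disc]` exactly, and the collapse of the core piece -/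

namespace HolomorphicChain

variable [MeasurableSpace V] [BorelSpace V] {Ω : Opens V} {q : ℕ}

variable (T : HolomorphicChain 𝓘(ℂ, V) Ω (q + 1)) {b : V} {r₀ : ℝ} (hr₀ : 0 < r₀)
  (hΩ : closedBall b r₀ ⊆ (Ω : Set V)) (W : ChartWindow V) (hKp : finrank ℂ W.K = q + 1) {ρ₀ : ℝ}
  (hρ₀ : ρ₀ < 1) (hW : W.closedTube ⊆ closedBall (0 : V) ρ₀)
  (htube : ∀ r ∈ Ioo 0 r₀, T.blowUpSet b r ∩ W.closedTube ⊆ {x | ‖W.wf x‖ < W.τ / 16})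

/-- The closed disc `(m + K) ∩ {‖k‖ ≤ a₃}` is closed, and the projected core piece is supported in it.
[folklore] -/
theorem support_projPiece_subset_closedDisc {r : ℝ} {M : ℝ}
    (htube₁ : T.blowUpSet b r ∩ W.closedTube ⊆ {x | ‖W.wf x‖ < W.τ / 16})
    (hM : ∀ k ∈ ball (0 : W.K) W.ρ, ‖fderiv ℂ W.Ψ k‖ ≤ M) :
    (T.projPiece b r W hM).support ⊆ {x | x - W.m ∈ W.K} ∩ {x | ‖W.kf x‖ ≤ W.a₃} := by
  have hcl : IsClosed ({x : V | x - W.m ∈ W.K} ∩ {x | ‖W.kf x‖ ≤ W.a₃}) := by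
    refine IsClosed.inter ?_ (isClosed_le (continuous_norm.comp W.contDiff_kf.continuous) continuous_const)
    have : {x : V | x - W.m ∈ W.K} = (fun x => x - W.m) ⁻¹' (W.K : Set V) := rfl
    rw [this]
    exact (Submodule.closed_of_finiteDimensional W.K).preimage (continuous_id.sub continuous_const)
  refine ((T.corePiece b r W).support_pushforward_subset (W.cutoff hM) W.contDiff_proj).trans
    (closure_minimal ?_ hcl)
  rintro _ ⟨x, ⟨-, hx⟩, rfl⟩
  exact ⟨W.proj_sub_mem x, by
    rw [mem_setOf_eq, W.kf_proj]; exact (support_corePiece_subset T W htube₁ hx).1⟩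

include hKp in
/-- The rim circle `(m + K) ∩ {‖k‖ = a₃}` is `𝓗^{2p}`-null. [folklore] -/
theorem measure_plane_inter_sphere_eq_zero :
    letI : InnerProductSpace ℝ V := InnerProductSpace.complexToReal
    (μHE[2 * (q + 1)] : Measure V) ({x | x - W.m ∈ W.K} ∩ {x | ‖W.kf x‖ = W.a₃}) = 0 := by
  letI : InnerProductSpace ℝ V := InnerProductSpace.complexToReal
  letI : InnerProductSpace ℝ W.K := InnerProductSpace.complexToReal
  haveI : FiniteDimensional ℝ W.K := FiniteDimensional.complexToReal W.K
  have hiso : Isometry (fun k : W.K => W.m + (k : V)) := Isometry.of_dist_eq fun x y => by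
    rw [dist_eq_norm, dist_eq_norm, add_sub_add_left_eq_sub, ← Submodule.coe_sub, Submodule.coe_norm]
  have hdim : finrank ℝ W.K = 2 * (q + 1) := by rw [finrank_real_of_complex, hKp]
  have hset : {x : V | x - W.m ∈ W.K} ∩ {x | ‖W.kf x‖ = W.a₃} =
      (fun k : W.K => W.m + (k : V)) '' sphere (0 : W.K) W.a₃ := by
    ext x
    simp only [mem_inter_iff, mem_setOf_eq, mem_image, mem_sphere_zero_iff_norm]
    constructor
    · rintro ⟨hx, hk⟩
      refine ⟨⟨x - W.m, hx⟩, ?_, by simp⟩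
      have : W.kf x = ⟨x - W.m, hx⟩ := by
        simp only [ChartWindow.kf]; exact W.K.orthogonalProjectionOnto_mem_subspace_eq_self ⟨x - W.m, hx⟩
      rwa [this] at hk
    · rintro ⟨k, hk, rfl⟩
      have : W.kf (W.m + (k : V)) = k := by
        simp only [ChartWindow.kf, add_sub_cancel_left]
        exact W.K.orthogonalProjectionOnto_mem_subspace_eq_self k
      exact ⟨by simp, by rwa [this]⟩
  rw [hset, hiso.euclideanHausdorffMeasure_image, ← hdim, InnerProductSpace.euclideanHausdorffMeasure_eq_volume]
  exact Measure.addHaar_sphere_of_ne_zero _ _ W.a₃_pos.ne'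

include hΩ hKp hρ₀ hW htube in
/-- **`Q_r = c · [disc]` exactly**: if the sheet identity `Q_r ⌞ {‖k‖ < a₃} = c·[disc]` holds,
then `Q_r = c·[disc]` (the remainder is a rectifiable current carried by the null rim circle).
[cite: Federer1969, 4.1.28, 4.1.31] -/
theorem projPiece_eq_disc {M : ℝ} (hM : ∀ k ∈ ball (0 : W.K) W.ρ, ‖fderiv ℂ W.Ψ k‖ ≤ M)
    (e' : Fin (2 * (q + 1)) → V) {c : ℤ} {r : ℝ} (hr : r ∈ Ioo 0 r₀)
    (hQr : (T.projPiece b r W hM).IsRepresentable)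
    (hc : hQr.restrictSet W.slab W.isOpen_slab.measurableSet =
      currentOfIntegration (W.slab ∩ {x | x - W.m ∈ W.K}) (fun _ => c) (fun _ => e')) :
    T.projPiece b r W hM =
      currentOfIntegration (W.slab ∩ {x | x - W.m ∈ W.K}) (fun _ => c) (fun _ => e') := by
  letI : InnerProductSpace ℝ V := InnerProductSpace.complexToReal
  have hball : ball b r ⊆ (Ω : Set V) :=
    (ball_subset_closedBall.trans (closedBall_subset_closedBall hr.2.le)).trans hΩ
  have hQ := isRectifiable_projPiece T hr.1 hball W hρ₀ hW (htube r hr) hM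
  obtain ⟨⟨W', θ', ξ', hdata, hQeq⟩, -⟩ := hQ
  -- the remainder `Q ⌞ slabᶜ`
  have hrest : hQr.restrictSet W.slabᶜ W.isOpen_slab.measurableSet.compl =
      currentOfIntegration (W' ∩ W.slabᶜ) θ' ξ' := by
    have key : ∀ (S : Current (⊤ : Opens V) (2 * (q + 1))) (hS : S.IsRepresentable),
        S = currentOfIntegration W' θ' ξ' →
          hS.restrictSet W.slabᶜ W.isOpen_slab.measurableSet.compl =
            currentOfIntegration (W' ∩ W.slabᶜ) θ' ξ' := by
      rintro S hS rfl
      exact hdata.restrictSet_eq _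
    exact key _ hQr hQeq
  have hsum := hQr.restrictSet_add_compl W.isOpen_slab.measurableSet
  rw [hc, hrest] at hsum
  -- the remainder is locally rectifiable and carried by the rim circle
  have hloc : (currentOfIntegration (W' ∩ W.slabᶜ) θ' ξ' : Current (⊤ : Opens V) (2 * (q + 1))).IsLocallyRectifiable :=
    ⟨_, _, _, hdata.inter W.isOpen_slab.measurableSet.compl, rfl⟩
  have hsupp1 : (currentOfIntegration (W' ∩ W.slabᶜ) θ' ξ' : Current (⊤ : Opens V) (2 * (q + 1))).support ⊆
      {x | W.a₃ ≤ ‖W.kf x‖} := by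
    refine (support_currentOfIntegration_subset_closure _ _ _).trans (closure_minimal ?_ ?_)
    · intro x hx
      have h2 : x ∉ W.slab := hx.2
      simp only [ChartWindow.slab, mem_setOf_eq, not_lt] at h2
      exact h2
    · exact isClosed_le continuous_const (continuous_norm.comp W.contDiff_kf.continuous)
  have hsupp2 : (currentOfIntegration (W' ∩ W.slabᶜ) θ' ξ' : Current (⊤ : Opens V) (2 * (q + 1))).support ⊆
      {x | x - W.m ∈ W.K} ∩ {x | ‖W.kf x‖ ≤ W.a₃} := by
    -- `Q ⌞ slabᶜ = Q - c·[disc]`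
    have heq : (currentOfIntegration (W' ∩ W.slabᶜ) θ' ξ' : Current (⊤ : Opens V) (2 * (q + 1))) =
        T.projPiece b r W hM +
          -(currentOfIntegration (W.slab ∩ {x | x - W.m ∈ W.K}) (fun _ => c) (fun _ => e')) := by
      rw [← hsum]; abel
    rw [heq]
    refine (Current.support_add_subset _ _).trans (union_subset ?_ ?_)
    · exact support_projPiece_subset_closedDisc T W (htube r hr) hM
    · rw [Current.support_neg]
      refine (support_currentOfIntegration_subset_closure _ _ _).trans (closure_minimal ?_ ?_)
      · intro x hx
        have h1 : ‖W.kf x‖ < W.a₃ := hx.1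
        exact ⟨hx.2, h1.le⟩
      · refine IsClosed.inter ?_ (isClosed_le (continuous_norm.comp W.contDiff_kf.continuous) continuous_const)
        have : {x : V | x - W.m ∈ W.K} = (fun x => x - W.m) ⁻¹' (W.K : Set V) := rfl
        rw [this]
        exact (Submodule.closed_of_finiteDimensional W.K).preimage (continuous_id.sub continuous_const)
  have hsupp : (currentOfIntegration (W' ∩ W.slabᶜ) θ' ξ' : Current (⊤ : Opens V) (2 * (q + 1))).support ⊆
      {x | x - W.m ∈ W.K} ∩ {x | ‖W.kf x‖ = W.a₃} := fun x hx =>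
    ⟨(hsupp2 hx).1, le_antisymm (hsupp2 hx).2 (hsupp1 hx)⟩
  have hzero := hloc.eq_zero_of_support_subset_null hsupp (measure_plane_inter_sphere_eq_zero W hKp)
  rw [hzero, add_zero] at hsum
  exact hsum.symm

include hΩ hKp hρ₀ hW htube in
/-- **The collapse of the core piece is `c` times the graph current**:
`h_#(D_r ⌞ innerCore) = c · [Γ]` for every `0 < r < r₀`, `c` the sheet number of the window.
[cite: Federer1969, 4.1.7, 4.1.30, 4.3.16–4.3.18; King 1971, §5] -/
theorem collapse_pushforward_corePiece {M : ℝ} (hM : ∀ k ∈ ball (0 : W.K) W.ρ, ‖fderiv ℂ W.Ψ k‖ ≤ M)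
    (e : letI : InnerProductSpace ℝ W.K := InnerProductSpace.complexToReal
      OrthonormalBasis (Fin (2 * (q + 1))) ℝ W.K)
    {c : ℤ} {r : ℝ} (hr : r ∈ Ioo 0 r₀) (hQr : (T.projPiece b r W hM).IsRepresentable)
    (hc : hQr.restrictSet W.slab W.isOpen_slab.measurableSet =
      currentOfIntegration (W.slab ∩ {x | x - W.m ∈ W.K}) (fun _ => c)
        (fun _ => fun i => ((e i : W.K) : V))) :
    letI : InnerProductSpace ℝ V := InnerProductSpace.complexToReal
    (T.corePiece b r W).pushforward ⊤ (W.cutoff hM) W.contDiff_collapse =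
      (c : ℝ) • W.graphCurrent e 1 W.a₃ := by
  letI : InnerProductSpace ℝ V := InnerProductSpace.complexToReal
  letI : InnerProductSpace ℝ W.K := InnerProductSpace.complexToReal
  haveI : FiniteDimensional ℝ W.K := FiniteDimensional.complexToReal W.K
  haveI : ProperSpace W.K := FiniteDimensional.proper ℝ W.K
  have htube₁ := htube r hr
  -- Step 1: `h = g` near the support
  have hsuppC : (T.corePiece b r W).support ⊆ W.coreOpen := fun x hx =>
    ⟨lt_of_le_of_lt (support_corePiece_subset T W htube₁ hx).1 W.a₃_lt,
      lt_of_le_of_lt (support_corePiece_subset T W htube₁ hx).2 (by linarith [W.τ_pos])⟩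
  rw [(T.corePiece b r W).pushforward_congr_fun_of_eqOn (W.cutoff hM) W.contDiff_collapse
    W.contDiff_graphMap W.isOpen_coreOpen hsuppC fun x hx => W.collapse_eq_graphMap hx.1 hx.2]
  -- Step 2: a cutoff `χ' = 1` near the closed disc, and `g_# = g_# ∘ q_#`
  have hKc : IsCompact ((fun k : W.K => W.m + (k : V)) '' closedBall (0 : W.K) W.a₃) :=
    (isCompact_closedBall _ _).image (continuous_const.add continuous_subtype_val)
  obtain ⟨χ', U', hU'o, hKU', hχ'1, -⟩ := exists_testFunction_eq_one_nhds (Ω := (⊤ : Opens V)) hKc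
    (subset_univ _)
  have hdisc : {x : V | x - W.m ∈ W.K} ∩ {x | ‖W.kf x‖ ≤ W.a₃} ⊆
      (fun k : W.K => W.m + (k : V)) '' closedBall (0 : W.K) W.a₃ := by
    rintro x ⟨hx, hk⟩
    refine ⟨⟨x - W.m, hx⟩, ?_, by simp⟩
    have : W.kf x = ⟨x - W.m, hx⟩ := by
      simp only [ChartWindow.kf]; exact W.K.orthogonalProjectionOnto_mem_subspace_eq_self ⟨x - W.m, hx⟩
    rw [mem_closedBall, dist_zero_right, ← this]; exact hk
  have h2 : (T.corePiece b r W).pushforward ⊤ (W.cutoff hM) W.contDiff_graphMap =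
      ((T.corePiece b r W).pushforward ⊤ (W.cutoff hM) W.contDiff_proj).pushforward ⊤ χ'
        W.contDiff_graphMap := by
    rw [Current.pushforward_pushforward,
      Current.pushforward_congr_fun _ _ (W.contDiff_graphMap.comp W.contDiff_proj) W.contDiff_graphMap
        fun x => W.graphMap_proj x]
    -- the cutoffs agree near the support
    refine (T.corePiece b r W).pushforward_congr_cutoff W.contDiff_graphMap
      (U := W.coreOpen ∩ W.proj ⁻¹' U') (W.isOpen_coreOpen.inter (hU'o.preimage W.contDiff_proj.continuous))
      (fun x hx => ⟨hsuppC hx, hKU' (hdisc ⟨W.proj_sub_mem x, ?_⟩)⟩) fun x hx => ?_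
    · rw [mem_setOf_eq, W.kf_proj]; exact (support_corePiece_subset T W htube₁ hx).1
    · rw [TestFunction.smulCompCLM_apply, hχ'1 _ hx.2, smul_eq_mul, mul_one]
  rw [h2]
  -- Step 3: `q_#(corePiece) = Q = c·[disc]` and `g_#(c·[disc]) = c·[Γ]`
  have hQ : (T.corePiece b r W).pushforward ⊤ (W.cutoff hM) W.contDiff_proj =
      currentOfIntegration (W.slab ∩ {x | x - W.m ∈ W.K}) (fun _ => c)
        (fun _ => fun i => ((e i : W.K) : V)) :=
    projPiece_eq_disc T hΩ W hKp hρ₀ hW htube hM _ hr hQr hc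
  rw [hQ]
  exact W.pushforward_disc_eq_graphCurrent hKp e c hM χ' hKU' hχ'1

end HolomorphicChain

end Literature.Geometry.Kaehler
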